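import Mathlib
import HarnessLib

/-!
# Crux `EfficiencyFloor.ProductionEfficiencyDecay` (stmt-NavierStokesRegularity-22866): ALGEBRA AT A VIOLATION
# INSTANT of the pointwise efficiency law (Lu–Doering window, uniform efficiency, radius bound)

`--supports stmt-NavierStokesRegularity-22866 --as helper` (line `efficiency_floor`; seat ns-ef-p4). Part I (pure
real algebra) of the violation-structure package; Part II (`…ViolationStructure.lean`) applies it along maximal
solutions.

SETTING. The registered crux-proper stub S2 (`stub_depletionGivenBudget`) asks, for the budget triple `(Z, Pal, S)`
of a maximal smooth Leray–Hopf solution (`Ż = 2S − 2ν·Pal`, `|S| ≤ c Z^{3/4} Pal^{3/4}`, the landed stmt-22995), that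
for every `ε > 0` eventually `Ż ≤ ε Z³`. An instant is an `ε`-VIOLATION if `ε Z³ < 2S − 2ν·Pal`. Here, with
`c, ν, ε, Z, Pal, S` six real numbers subject only to `ν, ε > 0`, `Z, Pal ≥ 0`, the envelope and the violation:

* `enstrophy_pos`, `palinstrophy_pos`, `const_pos`, `dissipation_lt`: `Z, Pal, c > 0` and `ν·Pal + (ε/2)Z³ < S`;
* `efficient`: UNIFORM EFFICIENCY `θ Z^{3/4} Pal^{3/4} ≤ S`, `θ(ν,ε) = (4ν/3)^{3/4}(2ε)^{1/4}` (weighted AM–GM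
  `x^{3/4}y^{1/4} ≤ ¾x + ¼y` with `x = 4ν·Pal/3`, `y = 2εZ³`) — the hypothesis of the landed structural lemma
  `EfficiencyConcentration` (stmt-23111) with `ε' = θ`;
* `palinstrophy_lt`, `enstrophy_cube_lt`: the LU–DOERING WINDOW `Z³ < (2c/ε)^{4/3}·Pal`, `Pal < (c/ν)⁴·Z³`
  (the planner's `ScaleOrDepletion` dichotomy, contrapositive: a violation pins the palinstrophy ratio to the compact
  window around the Lu–Doering optimum `Pal* = (3c/(4ν))⁴ Z³`);
* `sqrt_ratio_le`: the dissipation–production length obeys `(Z/Pal)^{1/2} ≤ (2c/ε)^{2/3}/Z`.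

HONEST FRAMING: inequalities between six real numbers; nothing about Navier–Stokes is used or asserted; the crux
stmt-22866 is NOT proved; no summit is proved. Reference for the envelope/optimum: L. Lu, C. R. Doering, Indiana
Univ. Math. J. 57 (2008) 2693–2727, eq. (5)–(6). [folklore]
-/

-- the problem directory repeats the summit name (`NavierStokesRegularity/NavierStokesRegularity`)
set_option linter.dupNamespace false

noncomputable section


namespace Summit.NavierStokesRegularity.NavierStokesRegularity.Theorems

namespace ProductionEfficiencyDecay

namespace Violation

/-! ### §1 Algebra at one violation instant -/

section algebra

variable {c ν ε Z P S : ℝ}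

/-- At an `ε`-violation instant (`ε Z³ < 2S − 2ν·Pal`, `ε > 0`, `Z, Pal ≥ 0`, `|S| ≤ c Z^{3/4} Pal^{3/4}`) the
enstrophy is positive. [folklore] -/
theorem enstrophy_pos (hν : 0 < ν) (hZ : 0 ≤ Z) (hP : 0 ≤ P)
    (hS : |S| ≤ c * Z ^ (3 / 4 : ℝ) * P ^ (3 / 4 : ℝ)) (hv : ε * Z ^ 3 < 2 * S - 2 * ν * P) : 0 < Z := by
  rcases hZ.lt_or_eq with h | h
  · exact h
  · exfalso
    rw [← h, Real.zero_rpow (by norm_num)] at hS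
    simp only [mul_zero, zero_mul, abs_nonpos_iff] at hS
    rw [← h, hS] at hv
    have : 0 ≤ 2 * ν * P := by positivity
    nlinarith

/-- At an `ε`-violation instant the dissipation and the Leray defect are dominated by the stretching:
`ν·Pal + (ε/2) Z³ < S`. [folklore] -/
theorem dissipation_lt (hv : ε * Z ^ 3 < 2 * S - 2 * ν * P) : ν * P + ε / 2 * Z ^ 3 < S := by
  linarith

/-- At an `ε`-violation instant the palinstrophy is positive. [folklore] -/
theorem palinstrophy_pos (hν : 0 < ν) (hε : 0 < ε) (hZ : 0 ≤ Z) (hP : 0 ≤ P)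
    (hS : |S| ≤ c * Z ^ (3 / 4 : ℝ) * P ^ (3 / 4 : ℝ)) (hv : ε * Z ^ 3 < 2 * S - 2 * ν * P) : 0 < P := by
  have hZp := enstrophy_pos hν hZ hP hS hv
  rcases hP.lt_or_eq with h | h
  · exact h
  · exfalso
    rw [← h, Real.zero_rpow (by norm_num)] at hS
    simp only [mul_zero, abs_nonpos_iff] at hS
    have h1 := dissipation_lt hv
    rw [hS, ← h] at h1
    have : 0 < ε / 2 * Z ^ 3 := by positivity
    linarith

/-- The budget constant is positive at a violation instant (so the window below is not vacuous). [folklore] -/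
theorem const_pos (hν : 0 < ν) (hε : 0 < ε) (hZ : 0 ≤ Z) (hP : 0 ≤ P)
    (hS : |S| ≤ c * Z ^ (3 / 4 : ℝ) * P ^ (3 / 4 : ℝ)) (hv : ε * Z ^ 3 < 2 * S - 2 * ν * P) : 0 < c := by
  have hZp := enstrophy_pos hν hZ hP hS hv
  have h1 := dissipation_lt hv
  have hSpos : 0 < S := by
    have : 0 < ε / 2 * Z ^ 3 := by positivity
    have : 0 ≤ ν * P := by positivity
    linarith
  have h2 : 0 < c * Z ^ (3 / 4 : ℝ) * P ^ (3 / 4 : ℝ) := hSpos.trans_le ((le_abs_self S).trans hS)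
  have h3 : 0 ≤ Z ^ (3 / 4 : ℝ) * P ^ (3 / 4 : ℝ) := by positivity
  by_contra hc
  rw [not_lt] at hc
  have : c * Z ^ (3 / 4 : ℝ) * P ^ (3 / 4 : ℝ) ≤ 0 := by
    rw [mul_assoc]; exact mul_nonpos_of_nonpos_of_nonneg hc h3
  linarith

/-- **Uniform efficiency at a violation instant** (weighted AM–GM): `θ Z^{3/4} Pal^{3/4} ≤ S` with
`θ = (4ν/3)^{3/4} (2ε)^{1/4}`, since `(4ν·Pal/3)^{3/4} (2εZ³)^{1/4} ≤ ν·Pal + (ε/2) Z³ < S`. [folklore] -/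
theorem efficient (hν : 0 < ν) (hε : 0 < ε) (hZ : 0 ≤ Z) (hP : 0 ≤ P)
    (hv : ε * Z ^ 3 < 2 * S - 2 * ν * P) :
    (4 * ν / 3) ^ (3 / 4 : ℝ) * (2 * ε) ^ (1 / 4 : ℝ) * Z ^ (3 / 4 : ℝ) * P ^ (3 / 4 : ℝ) ≤ S := by
  have h1 := dissipation_lt hv
  have hx : 0 ≤ 4 * ν * P / 3 := by positivity
  have hy : 0 ≤ 2 * ε * Z ^ 3 := by positivity
  have hamgm := Real.geom_mean_le_arith_mean2_weighted (w₁ := 3 / 4) (w₂ := 1 / 4) (by norm_num) (by norm_num)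
    hx hy (by norm_num)
  have hx' : (4 * ν * P / 3) ^ (3 / 4 : ℝ) = (4 * ν / 3) ^ (3 / 4 : ℝ) * P ^ (3 / 4 : ℝ) := by
    rw [show 4 * ν * P / 3 = 4 * ν / 3 * P by ring, Real.mul_rpow (by positivity) hP]
  have hy' : (2 * ε * Z ^ 3) ^ (1 / 4 : ℝ) = (2 * ε) ^ (1 / 4 : ℝ) * Z ^ (3 / 4 : ℝ) := by
    rw [Real.mul_rpow (by positivity) (pow_nonneg hZ 3), ← Real.rpow_natCast_mul hZ]
    norm_num
  rw [hx', hy'] at hamgm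
  have h2 : 3 / 4 * (4 * ν * P / 3) + 1 / 4 * (2 * ε * Z ^ 3) = ν * P + ε / 2 * Z ^ 3 := by ring
  rw [h2] at hamgm
  calc (4 * ν / 3) ^ (3 / 4 : ℝ) * (2 * ε) ^ (1 / 4 : ℝ) * Z ^ (3 / 4 : ℝ) * P ^ (3 / 4 : ℝ)
      = (4 * ν / 3) ^ (3 / 4 : ℝ) * P ^ (3 / 4 : ℝ) * ((2 * ε) ^ (1 / 4 : ℝ) * Z ^ (3 / 4 : ℝ)) := by ring
    _ ≤ ν * P + ε / 2 * Z ^ 3 := hamgm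
    _ ≤ S := h1.le

/-- The efficiency constant `θ(ν,ε) = (4ν/3)^{3/4} (2ε)^{1/4}` is positive. [folklore] -/
theorem theta_pos (hν : 0 < ν) (hε : 0 < ε) :
    0 < (4 * ν / 3) ^ (3 / 4 : ℝ) * (2 * ε) ^ (1 / 4 : ℝ) := by
  positivity

/-- **Lu–Doering window, upper edge**: at a violation instant `Pal < (c/ν)⁴ Z³` (from `ν·Pal < S ≤ c Z^{3/4} Pal^{3/4}`).
[cite: LuDoering2008, eq. (6)] -/
theorem palinstrophy_lt (hν : 0 < ν) (hε : 0 < ε) (hZ : 0 ≤ Z) (hP : 0 ≤ P)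
    (hS : |S| ≤ c * Z ^ (3 / 4 : ℝ) * P ^ (3 / 4 : ℝ)) (hv : ε * Z ^ 3 < 2 * S - 2 * ν * P) :
    P < (c / ν) ^ 4 * Z ^ 3 := by
  have hPp := palinstrophy_pos hν hε hZ hP hS hv
  have hcp := const_pos hν hε hZ hP hS hv
  set a : ℝ := P ^ (1 / 4 : ℝ) with ha_def
  set b : ℝ := Z ^ (3 / 4 : ℝ) with hb_def
  have ha : 0 < a := Real.rpow_pos_of_pos hPp _
  have hb : 0 ≤ b := Real.rpow_nonneg hZ _
  have hP1 : P = a ^ 4 := by rw [ha_def, ← Real.rpow_mul_natCast hP]; norm_num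
  have hP34 : P ^ (3 / 4 : ℝ) = a ^ 3 := by rw [ha_def, ← Real.rpow_mul_natCast hP]; norm_num
  have hZ3 : Z ^ 3 = b ^ 4 := by rw [hb_def, ← Real.rpow_mul_natCast hZ]; norm_num
  -- `ν a⁴ < c b a³`, so `ν a < c b`
  have h1 : ν * P < c * Z ^ (3 / 4 : ℝ) * P ^ (3 / 4 : ℝ) := by
    have := dissipation_lt hv
    have h0 : 0 ≤ ε / 2 * Z ^ 3 := by positivity
    exact lt_of_lt_of_le (by linarith) ((le_abs_self S).trans hS)
  rw [hP34, hP1] at h1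
  change ν * a ^ 4 < c * b * a ^ 3 at h1
  have h2 : ν * a < c * b := by
    have ha3 : 0 < a ^ 3 := pow_pos ha 3
    have : ν * a * a ^ 3 < c * b * a ^ 3 := by linarith [h1]
    exact lt_of_mul_lt_mul_right this ha3.le
  have h3 : a < c / ν * b := by
    rw [div_mul_eq_mul_div, lt_div_iff₀ hν]; linarith
  rw [hP1, hZ3, ← mul_pow]
  exact pow_lt_pow_left₀ h3 ha.le (by norm_num)

/-- **Lu–Doering window, lower edge**: at a violation instant `Z³ < (2c/ε)^{4/3} · Pal`
(from `(ε/2) Z³ < S ≤ c Z^{3/4} Pal^{3/4}`). [cite: LuDoering2008, eq. (6)] -/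
theorem enstrophy_cube_lt (hν : 0 < ν) (hε : 0 < ε) (hZ : 0 ≤ Z) (hP : 0 ≤ P)
    (hS : |S| ≤ c * Z ^ (3 / 4 : ℝ) * P ^ (3 / 4 : ℝ)) (hv : ε * Z ^ 3 < 2 * S - 2 * ν * P) :
    Z ^ 3 < (2 * c / ε) ^ (4 / 3 : ℝ) * P := by
  have hZp := enstrophy_pos hν hZ hP hS hv
  have hcp := const_pos hν hε hZ hP hS hv
  set a : ℝ := P ^ (1 / 4 : ℝ) with ha_def
  set b : ℝ := Z ^ (3 / 4 : ℝ) with hb_def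
  have ha : 0 ≤ a := Real.rpow_nonneg hP _
  have hb : 0 < b := Real.rpow_pos_of_pos hZp _
  have hP1 : P = a ^ 4 := by rw [ha_def, ← Real.rpow_mul_natCast hP]; norm_num
  have hP34 : P ^ (3 / 4 : ℝ) = a ^ 3 := by rw [ha_def, ← Real.rpow_mul_natCast hP]; norm_num
  have hZ3 : Z ^ 3 = b ^ 4 := by rw [hb_def, ← Real.rpow_mul_natCast hZ]; norm_num
  have hq : 0 < 2 * c / ε := by positivity
  set q : ℝ := (2 * c / ε) ^ (1 / 3 : ℝ) with hq_def
  have hq0 : 0 ≤ q := Real.rpow_nonneg hq.le _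
  have hq3 : q ^ 3 = 2 * c / ε := by
    rw [hq_def, show (1 / 3 : ℝ) = ((3 : ℕ) : ℝ)⁻¹ by norm_num, Real.rpow_inv_natCast_pow hq.le (by norm_num)]
  have hq4 : q ^ 4 = (2 * c / ε) ^ (4 / 3 : ℝ) := by
    rw [hq_def, ← Real.rpow_mul_natCast hq.le]; norm_num
  -- `(ε/2) b⁴ < c b a³`, so `b³ < (2c/ε) a³ = (q a)³`, so `b < q a`
  have h1 : ε / 2 * Z ^ 3 < c * Z ^ (3 / 4 : ℝ) * P ^ (3 / 4 : ℝ) := by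
    have := dissipation_lt hv
    have h0 : 0 ≤ ν * P := by positivity
    exact lt_of_lt_of_le (by linarith) ((le_abs_self S).trans hS)
  rw [hP34, hZ3] at h1
  change ε / 2 * b ^ 4 < c * b * a ^ 3 at h1
  have h2 : ε / 2 * b ^ 3 < c * a ^ 3 := by
    have : ε / 2 * b ^ 3 * b < c * a ^ 3 * b := by linarith [h1]
    exact lt_of_mul_lt_mul_right this hb.le
  have h3 : b ^ 3 < (q * a) ^ 3 := by
    rw [mul_pow, hq3, div_mul_eq_mul_div, lt_div_iff₀ hε]
    linarith
  have h4 : b < q * a := lt_of_pow_lt_pow_left₀ 3 (mul_nonneg hq0 ha) h3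
  rw [hZ3, hP1, ← hq4, ← mul_pow]
  exact pow_lt_pow_left₀ h4 hb.le (by norm_num)

/-- **Radius bound**: at a violation instant the dissipation–production length `(Z/Pal)^{1/2}` is at most
`(2c/ε)^{2/3} / Z`. [folklore] -/
theorem sqrt_ratio_le (hν : 0 < ν) (hε : 0 < ε) (hZ : 0 ≤ Z) (hP : 0 ≤ P)
    (hS : |S| ≤ c * Z ^ (3 / 4 : ℝ) * P ^ (3 / 4 : ℝ)) (hv : ε * Z ^ 3 < 2 * S - 2 * ν * P) :
    Real.sqrt (Z / P) ≤ (2 * c / ε) ^ (2 / 3 : ℝ) / Z := by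
  have hZp := enstrophy_pos hν hZ hP hS hv
  have hPp := palinstrophy_pos hν hε hZ hP hS hv
  have hcp := const_pos hν hε hZ hP hS hv
  have hlt := enstrophy_cube_lt hν hε hZ hP hS hv
  have hq : 0 ≤ 2 * c / ε := by positivity
  have hr0 : 0 ≤ (2 * c / ε) ^ (2 / 3 : ℝ) / Z := div_nonneg (Real.rpow_nonneg hq _) hZ
  rw [Real.sqrt_le_left hr0, div_pow, ← Real.rpow_mul_natCast hq]
  norm_num
  rw [div_le_div_iff₀ hPp (pow_pos hZp 2)]
  nlinarith [hlt, hZp]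

end algebra

end Violation

end ProductionEfficiencyDecay

end Summit.NavierStokesRegularity.NavierStokesRegularity.Theorems

end
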